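import Summits.Langlands.Langlands.Theorems.PicardMuOrdinaryMuOrdinaryFamilyRTCharZeroDefs
import Literature.NumberTheory.Automorphic.TunnellOctahedralGlobalProofs
import HarnessLib

/-!
# Crux `MuOrdinaryFamilyRT` (stmt-Langlands-13757), line `char-zero-dominance`: the REDUCTION
# (the seven stubs imply the crux, by name — kernel-checked in the tree)

Companion of `…CharZeroDefs.lean` (vocabulary, `OrdFamily`, dominance lemma, statements of the open stubs).  This
file lands the composition `MuOrdinaryFamilyRT_of` of the registered gen-2 skeleton
`Cruxes/MuOrdinaryFamilyRT/Lines/char_zero_dominance.lean` VERBATIM (pure logic plus the dominance lemma; no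
`sorry`): for generic `f`, Stub 1 (`S.stub_picardInput`, landed conditionally p86963) gives `ρ_C`; outside the main
class the conceded `S.stub_remainder`; inside it K2 (`S.stub_charZeroFamily`: a 4-dimensional `OrdFamily` through
`ρ_C`) → K1 (`S.stub_definiteHost`: finiteness over `Λ` + classicality over `F'`) → dominance
(`algebraMap_injective_of_ringKrullDim_le`, proved) → accumulation (`S.stub_accumulation`, landed p85419) → quadratic
descent (`S.stub_quadraticDescent`, landed conditionally p90012) → dictionary (`S.stub_dictionary`, landed p85480).
And the FACT FORM `MuOrdinaryFamilyRT_of_facts`: feeding the landed stubs, the crux follows from the two open stubs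
K2, K1, the conceded remainder, and the two Literature fact debts `S.stub_picardFact`, `S.stub_descentFacts` (the
quadratic-sign twist being the tree's theorem `exists_twist_quadraticSign_holds`) — the exact shape in which the third
line lead hands the crux back for re-lining (`promote-stub`).  Both theorems are CONDITIONAL (they credit nothing
to the item); they make the line's reduction durable and citable.
-/

set_option linter.dupNamespace false

namespace Summit.Langlands.Langlands.Cruxes.MuOrdinaryFamilyRT.CharZeroDominance

open scoped NumberField Polynomial Matrix Classical
open Field IsDedekindDomain Polynomial
open Literature.NumberTheory.GaloisRepresentations Literature.NumberTheory.Automorphic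

noncomputable section

/-- **The line concludes the crux.**  For generic `f`: `stub_picardInput` (`ρ_C`) first; then outside
the main class `MainClass f ρ_C` by `stub_remainder` (which alone consumes the residual hypothesis);
inside it: `stub_charZeroFamily` (an integral `4`-dimensional ordinary family `𝓕` through `ρ_C`: the
characteristic-zero count) → `stub_definiteHost` (`𝓕.R` finite over `𝓕.Λ`; arithmetic weights `D`;
classicality over `F'`) → `algebraMap_injective_of_ringKrullDim_le` (DOMINANCE `𝓕.Λ ↪ 𝓕.R`, proved) →
`stub_accumulation` (for each `k` an arithmetic point `y_k` with `‖y_k − x_C‖ ≤ 3^{-k}` on `𝓕.R`,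
hence `‖tr ρ_{y_k} − tr ρ_C‖ ≤ 3^{-k}` on `Γ_K`) → `stub_quadraticDescent` (`P_k` on `GL₃(𝔸_K)`,
level `S`, integral, compatible with `ρ_{y_k}`) → `stub_dictionary` (the typed congruence at every
`𝔭 ∉ S ∪ S₀`). -/
theorem MuOrdinaryFamilyRT_of : S.stub_picardInput → S.stub_charZeroFamily → S.stub_definiteHost → S.stub_accumulation → S.stub_quadraticDescent → S.stub_dictionary → S.stub_remainder → Summit.Langlands.Langlands.Theses.PicardMuOrdinary.MuOrdinaryFamilyRT := by
  intro h₁ h₂ h₃ h₄ h₅ h₆ h₇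
  refine crux_iff.mpr ?_
  intro f hcpt hdeg hsep hgal hres
  have hgen : Generic f := ⟨hdeg, hsep, hgal⟩
  -- Stub 1: the Picard representation and its Frobenius traces
  obtain ⟨ι, e, S₀, ρC, hin⟩ := h₁ f hgen
  -- the scope (gen 2): μ-ordinarity of ρ_C at λ (Galois side) and S₄ image; else the conceded remainder
  by_cases hM : MainClass f ρC
  swap
  · exact h₇ f hcpt ι e S₀ ρC hgen hin hM hres
  have hmu : IsMuOrdinaryAtThree ρC := hM.1
  have hS₀ : ∀ v : HeightOneSpectrum (𝓞 K), ((3 : ℕ) : 𝓞 K) ∈ v.asIdeal → v ∈ S₀ := hin.1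
  have htr := hin.2.2
  -- Stub 2 (the lever): an integral ordinary family of dimension ≥ 4 through ρ_C
  obtain ⟨𝓕, hdim⟩ := h₂ f ι e S₀ ρC hgen hin hmu
  -- Stub 3 (the host): finiteness over Λ, arithmetic weights, classicality over F'
  obtain ⟨hfin, F', _instF, _instNF, _instA, hcpt', S', D, E, hdegF', hE, hS', hDint, hDacc,
      hclass⟩ := h₃ f ι e S₀ ρC 𝓕 hgen hin hM hdim
  haveI : Module.Finite 𝓕.Λ 𝓕.R := hfin
  -- DOMINANCE (kernel-checked): Λ ↪ R, i.e. the prime ⊥ of the integral family lies over ⊥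
  have hinj : Function.Injective (algebraMap 𝓕.Λ 𝓕.R) :=
    algebraMap_injective_of_ringKrullDim_le 𝓕.dim_le hdim
  -- the Picard point as a ℚ̄₃-valued point of R
  let xq : 𝓕.R →+* PadicAlgCl 3 := 𝓕.j.comp (𝓕.x : 𝓕.R →+* 𝓕.𝒪)
  have hxq : ∀ r, xq r = 𝓕.j (𝓕.x r) := fun r => rfl
  have hdom : ∃ 𝔮 : Ideal 𝓕.R, 𝔮.IsPrime ∧ Ideal.comap (algebraMap 𝓕.Λ 𝓕.R) 𝔮 = ⊥ ∧
      ∀ r ∈ 𝔮, xq r = 0 := by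
    refine ⟨⊥, Ideal.isPrime_bot, ?_, fun r hr => ?_⟩
    · rw [← RingHom.ker_eq_comap_bot]
      exact (RingHom.injective_iff_ker_eq_bot _).mp hinj
    · rw [Ideal.mem_bot] at hr
      rw [hr, map_zero]
  have hxint : ∀ a : 𝓕.Λ, ‖xq (algebraMap 𝓕.Λ 𝓕.R a)‖ ≤ 1 := fun a => by
    rw [hxq]; exact 𝓕.j_norm_le _
  have hDacc' : ∀ M : ℕ, ∃ κ ∈ D, ∀ a : 𝓕.Λ,
      ‖κ a - xq (algebraMap 𝓕.Λ 𝓕.R a)‖ ≤ ((3 : ℝ)⁻¹) ^ M := by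
    intro M
    obtain ⟨κ, hκ, h⟩ := hDacc M
    exact ⟨κ, hκ, fun a => by rw [hxq]; exact h a⟩
  -- Stub 5: the descent datum (a level S over K, uniform in the point)
  obtain ⟨S, hdesc⟩ := h₅ F' hdegF' hcpt hcpt' ι S'
  -- Stub 6: the maximal ideal 𝔐 of ℤ̄ cut out by ι
  obtain ⟨𝔐, h𝔐max, h𝔐3, hdict⟩ := h₆ ι e
  refine ⟨e, 𝔐, S ∪ S₀, h𝔐max, h𝔐3, fun k => ?_⟩
  -- Stub 4: an arithmetic point y of R with ‖y − x‖ ≤ 3^{-k} uniformly on R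
  obtain ⟨y, hyD, hyx⟩ := h₄ 𝓕.Λ 𝓕.R xq D E hE hdom hxint hDint hDacc' k
  obtain ⟨ρy, hρyT, hρyirr, P', hP'reg, hP'⟩ := hclass y hyD
  obtain ⟨P, hPreg, hP⟩ := hdesc ρy P' hρyirr hP'reg hP'
  refine ⟨P, hPreg, fun 𝔭 h𝔭 => ?_⟩
  have h𝔭S : 𝔭 ∉ S := fun h => h𝔭 (Finset.mem_union_left _ h)
  have h𝔭S₀ : 𝔭 ∉ S₀ := fun h => h𝔭 (Finset.mem_union_right _ h)
  have h3 : ((3 : ℕ) : 𝓞 K) ∉ 𝔭.asIdeal := fun h => h𝔭S₀ (hS₀ 𝔭 h)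
  obtain ⟨⟨α, t₀, hα, ht₀⟩, hcomp⟩ := hP 𝔭 h𝔭S
  have happrox : ∀ g, ‖FramedRep.trace ρy g - FramedRep.trace ρC g‖ ≤ ((3 : ℝ)⁻¹) ^ k := by
    intro g
    rw [hρyT g, ← 𝓕.x_trace g, ← hxq]
    exact hyx _
  obtain ⟨t, u, ht, hu, hut⟩ :=
    hdict k f ρC ρy 𝔭 α t₀ h3 (htr 𝔭 h𝔭S₀) ((hcomp h3) α hα).2 ht₀ happrox
  exact ⟨α, t, u, hα, ht, hu, hut⟩

/-- **The crux from K2, K1, the remainder and the fact debts.**  `MuOrdinaryFamilyRT_of` fed with the landed stubs: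
Stub 1 from `S.stub_picardFact` (`stub_picardInput_of`), Stub 4 (`stub_accumulation`), Stub 5 from
`S.stub_descentFacts` and the tree's `exists_twist_quadraticSign_holds` (`stub_quadraticDescent_of`), Stub 6
(`stub_dictionary`).  What remains is exactly: K2, K1, the conceded remainder, and two Literature debts. -/
theorem MuOrdinaryFamilyRT_of_facts : S.stub_picardFact → S.stub_charZeroFamily → S.stub_definiteHost → S.stub_descentFacts → S.stub_remainder → Summit.Langlands.Langlands.Theses.PicardMuOrdinary.MuOrdinaryFamilyRT := by
  intro hA h₂ h₃ hB h₇
  exact MuOrdinaryFamilyRT_of (stub_picardInput_of hA) h₂ h₃ stub_accumulation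
    (stub_quadraticDescent_of hB.1 hB.2.1 Literature.NumberTheory.Automorphic.exists_twist_quadraticSign_holds
      hB.2.2.1 hB.2.2.2.1 hB.2.2.2.2)
    stub_dictionary h₇

end

end Summit.Langlands.Langlands.Cruxes.MuOrdinaryFamilyRT.CharZeroDominance
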